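import Mathlib
import HarnessLib
import Literature.Analysis.FluidPDE.AxisymNoSwirlScalarEq
import Literature.Analysis.FluidPDE.AxisymNoSwirlVorticity
import Literature.Analysis.FluidPDE.SwirlTransportProofs
import Summits.NavierStokesRegularity.NavierStokesRegularity.Theorems.UnthreadedDoorPotentialEvolutionCore

/-!
# Route `UnthreadedDoor`, crux `PoloidalLiouville` (stmt-NavierStokesRegularity-1222), WALL W1 `stub_scalarLiouville` —
# crux idea «capsym-comparison» (ns-idea-13 g0), line input FL-C `CapSym.ZonalToroidalLiouville`: STRUCTURE BRICKS

KEY-NS #150 (2) / DIRECTOR-NS #246 (4): FL-C (the linear heart of KNSS Thm 5.2 with a GIVEN zonal swirl-free drift) exceeds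
this seat's wall; per the ruling the typed statement is landed (`…UnthreadedDoorCapSymDefs`, p648659) and the proof state is
handed off.  This file lands the frozen-time STRUCTURE bricks of that proof (steps (2)–(3) of the handoff plan
`FLC-HANDOFF.md`, evidence on 1222), all pointwise vector calculus in the tree's axisymmetric vocabulary (axis `e₂`,
generator `Jx = rotGen x = (−x₁, x₀, 0)`):

* `CapSym.fderiv_rotGen_eq` — `DU(x)[Jx] = x₀ ∂₁U − x₁ ∂₀U` in gradient coordinates;
* `CapSym.cross_gradient_apply_two_eq_zero`, `CapSym.horizontal_inner_cross_gradient_eq_zero` — for a scalar `U` with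
  `DU(x)[Jx] = 0` (infinitesimal axisymmetry, `IsAxisymmetricScalar.fderiv_rotGen`) the toroidal field `B = ∇U × x` is
  HORIZONTAL-ROTATIONAL: `B₂ = 0` and `x₀B₀ + x₁B₁ = 0` — the two structure hypotheses of `eq_hadamardQuotFst_smul_rotGen`;
* `CapSym.contDiff_cross_gradient` — `B ∈ Cⁿ` for `U ∈ Cⁿ⁺¹`;
* `CapSym.cross_gradient_eq_hadamardQuotFst_smul_rotGen` — hence `B = f · J` with the smooth Hadamard quotient
  `f = hadamardQuotFst (B ·)₁` (`= B_φ/ϖ`, the `η̃` of the card), for `U ∈ C²` axisymmetric;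
* `CapSym.transport_terms_eq_of_smul_rotGen` / `CapSym.inner_transport_terms_rotGen_eq` — the transport-stretching-diffusion
  terms of a field `B = f · J` carried by a drift `V` with `DV(x)[Jx] = J V(x)` (infinitesimal axisymmetry,
  `IsAxisymmetric.fderiv_rotGen`): `ΔB − DB[V x] + DV[B x] = (Δf − Df[V x]) Jx + 2 J∇f` and its pairing with `Jx`,
  `= ϖ²(Δf − Df[V x]) + 2(x₀∂₀f + x₁∂₁f)` — KNSS (5.10) for a transported field which is NOT the curl of the drift (the
  tree's `vorticity_terms_eq_of_smul_rotGen` is the case `B = curl V`).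

WHAT THIS IS NOT: no NS-regularity statement is touched; FL-C itself (`CapSym.ZonalToroidalLiouville`) is NOT proved here —
remaining steps: (1) curl of the potential-form equation ⇒ the induction equation for `B`, (4) the `SO(4)` lift to `ℝ⁵` and
`KNSSMaxPrincipleR5.eq_zero_of_abs_mul_le KNSS2009_lemma21_halfball_holds` (see `FLC-HANDOFF.md`); `PoloidalLiouville` (1222),
its wall and the summit stay OPEN.  `--supports stmt-NavierStokesRegularity-1222 --as helper`.
[cite: KochNadirashviliSereginSverak2009, §5 (5.10) and Thm 5.2 (Acta Math. 203, pp. 97–98)]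
-/

noncomputable section

-- the summit and its single sub-problem share the name (CONVENTIONS §1)
set_option linter.dupNamespace false

open Set Function Filter Topology InnerProductSpace
open scoped RealInnerProductSpace Laplacian ContDiff

namespace Summit.NavierStokesRegularity.NavierStokesRegularity.Theorems.PoloidalLiouville.CapSym

open Literature.Analysis Literature.Analysis.FluidPDE

/-! ### The toroidal field `B = ∇U × x` of a zonal potential is horizontal-rotational -/

/-- `DU(x)[Jx] = x₀ ∂₁U(x) − x₁ ∂₀U(x)` in the coordinates of the gradient. [folklore] -/
theorem fderiv_rotGen_eq (U : EuclideanSpace ℝ (Fin 3) → ℝ) (x : EuclideanSpace ℝ (Fin 3)) :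
    fderiv ℝ U x (rotGen x) = x 0 * gradient U x 1 - x 1 * gradient U x 0 := by
  rw [← LocalHelmholtz.inner_gradient_left_eq_fderiv, Tao2016.real_inner_fin3]
  simp only [rotGen_apply_zero, rotGen_apply_one, rotGen_apply_two]
  ring

/-- **`B₂ = 0`**: for a scalar `U` with `DU(x)[Jx] = 0`, `(∇U(x) × x)₂ = 0`. [folklore] -/
theorem cross_gradient_apply_two_eq_zero {U : EuclideanSpace ℝ (Fin 3) → ℝ} {x : EuclideanSpace ℝ (Fin 3)}
    (hax : fderiv ℝ U x (rotGen x) = 0) : cross (gradient U x) x 2 = 0 := by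
  rw [fderiv_rotGen_eq] at hax
  rw [cross_apply_two]
  linarith

/-- **`x₀B₀ + x₁B₁ = 0`**: for a scalar `U` with `DU(x)[Jx] = 0`, the field `B = ∇U × x` has no cylindrical-radial
component. [folklore] -/
theorem horizontal_inner_cross_gradient_eq_zero {U : EuclideanSpace ℝ (Fin 3) → ℝ} {x : EuclideanSpace ℝ (Fin 3)}
    (hax : fderiv ℝ U x (rotGen x) = 0) :
    x 0 * cross (gradient U x) x 0 + x 1 * cross (gradient U x) x 1 = 0 := by
  rw [fderiv_rotGen_eq] at hax
  rw [cross_apply_zero, cross_apply_one]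
  linear_combination x 2 * hax

/-- **Smoothness of `B = ∇U × x`**: `U ∈ Cⁿ⁺¹ ⇒ B ∈ Cⁿ`. [folklore] -/
theorem contDiff_cross_gradient {U : EuclideanSpace ℝ (Fin 3) → ℝ} {n : ℕ∞}
    (hU : ContDiff ℝ ((n : WithTop ℕ∞) + 1) U) :
    ContDiff ℝ n (fun y : EuclideanSpace ℝ (Fin 3) => cross (gradient U y) y) := by
  have hg : ContDiff ℝ n (gradient U) :=
    (InnerProductSpace.toDual ℝ (EuclideanSpace ℝ (Fin 3))).symm.contDiff.comp (hU.fderiv_right (m := n) le_rfl)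
  have h := (crossCLM.contDiff.comp hg).clm_apply (contDiff_id (𝕜 := ℝ) (E := EuclideanSpace ℝ (Fin 3)))
  have e : (fun y : EuclideanSpace ℝ (Fin 3) => cross (gradient U y) y) =
      fun y => (crossCLM ∘ gradient U) y (id y) := by
    funext y; simp only [Function.comp_apply, crossCLM_apply, id]
  rw [e]
  exact h

/-- **`B = f · J`**: for `U ∈ C²` axisymmetric about the `e₂`-axis, the toroidal field `B = ∇U × x` is
`hadamardQuotFst (B ·)₁ · J` (the smooth quotient `B_φ/ϖ` times `Jx = ϖ e_φ`), by `eq_hadamardQuotFst_smul_rotGen`.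
[cite: KochNadirashviliSereginSverak2009, §5 pp. 97–98 and Remark 5.1] -/
theorem cross_gradient_eq_hadamardQuotFst_smul_rotGen {U : EuclideanSpace ℝ (Fin 3) → ℝ} (hU : ContDiff ℝ 2 U)
    (hax : IsAxisymmetricScalar U) (x : EuclideanSpace ℝ (Fin 3)) :
    cross (gradient U x) x =
      hadamardQuotFst (fun y : EuclideanSpace ℝ (Fin 3) => cross (gradient U y) y 1) x • rotGen x := by
  have hB : ContDiff ℝ 1 (fun y : EuclideanSpace ℝ (Fin 3) => cross (gradient U y) y) :=
    contDiff_cross_gradient (n := 1) (by exact_mod_cast hU)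
  have hd : Differentiable ℝ U := hU.differentiable (by norm_num)
  have h0 : ∀ y : EuclideanSpace ℝ (Fin 3), fderiv ℝ U y (rotGen y) = 0 := fun y => hax.fderiv_rotGen (hd y)
  exact eq_hadamardQuotFst_smul_rotGen hB (fun y => cross_gradient_apply_two_eq_zero (h0 y))
    (fun y => horizontal_inner_cross_gradient_eq_zero (h0 y)) x

/-- The Hadamard quotient `f = (∇U × ·)₁ / x₀` of the toroidal field of a `Cⁿ⁺²` potential is `Cⁿ`. [folklore] -/
theorem contDiff_hadamardQuotFst_cross_gradient {U : EuclideanSpace ℝ (Fin 3) → ℝ} {n : ℕ∞}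
    (hU : ContDiff ℝ (((n + 1 : ℕ∞) : WithTop ℕ∞) + 1) U) :
    ContDiff ℝ n (hadamardQuotFst fun y : EuclideanSpace ℝ (Fin 3) => cross (gradient U y) y 1) := by
  have hB : ContDiff ℝ (n + 1) (fun y : EuclideanSpace ℝ (Fin 3) => cross (gradient U y) y) :=
    contDiff_cross_gradient (n := n + 1) hU
  exact contDiff_hadamardQuotFst
    ((contDiff_piLp_apply (𝕜 := ℝ) (p := 2) (n := n + 1) (i := (1 : Fin 3))).comp hB)

/-! ### The transport–stretching–diffusion terms of `B = f · J` under an axisymmetric drift -/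

variable {f : EuclideanSpace ℝ (Fin 3) → ℝ}

/-- **KNSS (5.10) for a transported field.** Let `B = f · J` (`f ∈ C²`) and let the drift `V` be infinitesimally
axisymmetric at `x`, `DV(x)[Jx] = J V(x)`.  Then at `x`:
`ΔB − DB[V x] + DV[B x] = (Δf − Df[V x]) · Jx + 2 J(∇f)` — the stretching `DV[B] = f J V` cancels the rotation part
`f J V` of the transport term (the tree's `vorticity_terms_eq_of_smul_rotGen` is the case `B = curl V`).
[cite: KochNadirashviliSereginSverak2009, §5 (5.10) p. 97] -/
theorem transport_terms_eq_of_smul_rotGen {V B : EuclideanSpace ℝ (Fin 3) → EuclideanSpace ℝ (Fin 3)}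
    (hf : ContDiff ℝ 2 f) (hB : B = fun y => f y • rotGen y) {x : EuclideanSpace ℝ (Fin 3)}
    (hax : fderiv ℝ V x (rotGen x) = rotGen (V x)) :
    (Δ B) x - fderiv ℝ B x (V x) + fderiv ℝ V x (B x) =
      ((Δ f) x - fderiv ℝ f x (V x)) • rotGen x + (2 : ℝ) • rotGen (gradient f x) := by
  have hfd : DifferentiableAt ℝ f x := (hf.differentiable (by norm_num)) x
  rw [hB, laplacian_smul_rotGen hf x, fderiv_smul_rotGen_apply hfd (V x)]
  simp only [map_smul, hax, sub_smul]
  abel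

/-- **The scalar combination paired with `Jx`**: under the hypotheses of `transport_terms_eq_of_smul_rotGen`,
`⟪ΔB − DB[V x] + DV[B x], Jx⟫ = ϖ²(Δf − Df[V x]) + 2(x₀∂₀f + x₁∂₁f)`, `ϖ² = x₀² + x₁²`; off the axis this is `ϖ²` times
`Δf − Df[V x] + (2/ϖ)∂_ϖ f`, the spatial part of KNSS's (5.10) = the `ℝ⁵` Laplacian with drift on `SO(4)`-invariant functions.
[cite: KochNadirashviliSereginSverak2009, §5 (5.10) p. 97] -/
theorem inner_transport_terms_rotGen_eq {V B : EuclideanSpace ℝ (Fin 3) → EuclideanSpace ℝ (Fin 3)}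
    (hf : ContDiff ℝ 2 f) (hB : B = fun y => f y • rotGen y) {x : EuclideanSpace ℝ (Fin 3)}
    (hax : fderiv ℝ V x (rotGen x) = rotGen (V x)) :
    ⟪(Δ B) x - fderiv ℝ B x (V x) + fderiv ℝ V x (B x), rotGen x⟫ =
      (x 0 ^ 2 + x 1 ^ 2) * ((Δ f) x - fderiv ℝ f x (V x)) +
        2 * (x 0 * fderiv ℝ f x (EuclideanSpace.single 0 1) +
          x 1 * fderiv ℝ f x (EuclideanSpace.single 1 1)) := by
  rw [transport_terms_eq_of_smul_rotGen hf hB hax, inner_add_left, real_inner_smul_left,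
    real_inner_smul_left, inner_rotGen_self_eq, inner_rotGen_gradient_rotGen]
  ring

end Summit.NavierStokesRegularity.NavierStokesRegularity.Theorems.PoloidalLiouville.CapSym

end
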